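import Summits.Langlands.Langlands.Theorems.PhantomRMYoshidaResiduallyYoshidaLiftingFirstOrderReducibility
import Mathlib.Data.Matrix.Block
import Mathlib.LinearAlgebra.Matrix.GeneralLinearGroup.Defs
import Mathlib.Tactic.Abel
import HarnessLib

/-!
# Cup-product obstructions at first order for a block upper-triangular representation
# (stub `stub_firstOrderCupObstruction`) — line `sector-klingen-split`, crux `ResiduallyYoshidaLifting` (stmt-Langlands-13639)

Stub-worker of lead prover-line-stmt-Langlands-13639-c5-0 (2026-08-17), skeleton rev 15, sub-goal TL2 (the blockwise
characterisation of the first-order deformation cochains of the block representation `ρ̄_B`; companion of sub-goal TL,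
`PhantomRMYoshidaResiduallyYoshidaLiftingFirstOrderReducibility`).

Let `M = (A, B; 0, D)` and `M' = (A', B'; 0, D')` be block upper-triangular and `P, N, N'` arbitrary, all square matrices in
`2 × 2` blocks over a (non-unital, non-associative) ring.  Writing `P`, `N`, `N'` in blocks (`Matrix.fromBlocks_toBlocks`),
expanding the two products (`Matrix.fromBlocks_multiply`, `Matrix.fromBlocks_add`) and comparing blocks
(`Matrix.fromBlocks_inj`), the identity `P = M · N' + N · M'` reads

* `P₁₁ = A N'₁₁ + B N'₂₁ + N₁₁ A'`, `P₁₂ = A N'₁₂ + B N'₂₂ + N₁₁ B' + N₁₂ D'`,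
* `P₂₁ = D N'₂₁ + N₂₁ A'`, `P₂₂ = D N'₂₂ + N₂₁ B' + N₂₂ D'`,

i.e. (moving the "diagonal" terms to the left: `sub_eq_iff_eq_add`, `abel`) `P₂₁ = D N'₂₁ + N₂₁ A'`,
`P₁₁ - (A N'₁₁ + N₁₁ A') = B N'₂₁`, `P₂₂ - (D N'₂₂ + N₂₂ D') = N₂₁ B'` and `P₁₂ - (A N'₁₂ + N₁₂ D') = B N'₂₂ + N₁₁ B'`
(`eq_fromBlocks_zero₂₁_mul_add_mul_fromBlocks_zero₂₁_iff`).  Specialised to `P = N (g g')`, `N = N g`, `N' = N g'`,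
`M = M g = (σ g, B g; 0, σ' g)` and `M' = M g'` for a cochain `N : Γ → M₄(k)`, the derivation identity
`N (g g') = M g · N g' + N g · M g'` (`M + εN` is a homomorphism over `k[ε]`) holds for all `g, g'` iff blockwise: the
lower-left block `c = N₂₁` is a `Hom(σ, σ')`-cocycle, `δN₁₁ = B ∪ c`, `δN₂₂ = c ∪ B` and `δN₁₂ = B ∪ N₂₂ + N₁₁ ∪ B` — the
registered statement `stub_firstOrderCupObstruction` (the four `∀ g g'` are distributed over the conjunction by hand).

Pure Mathlib block-matrix algebra; no named facts.
-/

noncomputable section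

set_option linter.dupNamespace false
set_option autoImplicit false

open scoped Matrix

namespace Summit.Langlands.Langlands.Cruxes.ResiduallyYoshidaLifting.SectorKlingenSplit.Fibre

/-- Blockwise reading of `P = (A, B; 0, D) · N' + N · (A', B'; 0, D')` for block upper-triangular outer factors:
`P₂₁ = D N'₂₁ + N₂₁ A'`, `P₁₁ - (A N'₁₁ + N₁₁ A') = B N'₂₁`, `P₂₂ - (D N'₂₂ + N₂₂ D') = N₂₁ B'` and
`P₁₂ - (A N'₁₂ + N₁₂ D') = B N'₂₂ + N₁₁ B'`. [folklore] -/
theorem eq_fromBlocks_zero₂₁_mul_add_mul_fromBlocks_zero₂₁_iff {R : Type*} [NonUnitalNonAssocRing R] {m : Type*}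
    [Fintype m] (P N N' : Matrix (m ⊕ m) (m ⊕ m) R) (A B D A' B' D' : Matrix m m R) :
    P = Matrix.fromBlocks A B 0 D * N' + N * Matrix.fromBlocks A' B' 0 D' ↔
      P.toBlocks₂₁ = D * N'.toBlocks₂₁ + N.toBlocks₂₁ * A' ∧
        P.toBlocks₁₁ - (A * N'.toBlocks₁₁ + N.toBlocks₁₁ * A') = B * N'.toBlocks₂₁ ∧
        P.toBlocks₂₂ - (D * N'.toBlocks₂₂ + N.toBlocks₂₂ * D') = N.toBlocks₂₁ * B' ∧
        P.toBlocks₁₂ - (A * N'.toBlocks₁₂ + N.toBlocks₁₂ * D') = B * N'.toBlocks₂₂ + N.toBlocks₁₁ * B' := by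
  conv_lhs =>
    rw [← Matrix.fromBlocks_toBlocks P, ← Matrix.fromBlocks_toBlocks N, ← Matrix.fromBlocks_toBlocks N',
      Matrix.fromBlocks_multiply, Matrix.fromBlocks_multiply, Matrix.fromBlocks_add]
  rw [Matrix.fromBlocks_inj]
  simp only [Matrix.zero_mul, Matrix.mul_zero, zero_add, add_zero, sub_eq_iff_eq_add]
  constructor
  · rintro ⟨h₁₁, h₁₂, h₂₁, h₂₂⟩
    exact ⟨h₂₁, h₁₁.trans (by abel), h₂₂.trans (by abel), h₁₂.trans (by abel)⟩
  · rintro ⟨h₂₁, h₁₁, h₂₂, h₁₂⟩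
    exact ⟨h₁₁.trans (by abel), h₁₂.trans (by abel), h₂₁, h₂₂.trans (by abel)⟩

/-- **Registered sub-goal TL2 `stub_firstOrderCupObstruction`** (skeleton rev 15 of line `sector-klingen-split`; the
CUP-PRODUCT OBSTRUCTIONS at first order): a cochain `N : Γ → M₄(k)` in `2 × 2` blocks is a first-order deformation cochain
of `M g = (σ̄ g, B g; 0, σ̄' g)` (derivation identity `N(gg') = M g N g' + N g M g'`) IF AND ONLY IF blockwise: the
lower-left block `c = N₂₁` is a `Hom(σ̄, σ̄')`-cocycle, `δN₁₁ = B ∪ c` (`N₁₁(gg') - σ̄ g N₁₁ g' - N₁₁ g σ̄ g' = B g · c g'`),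
`δN₂₂ = c ∪ B` (`… = c g · B g'`), and `δN₁₂ = B ∪ N₂₂ + N₁₁ ∪ B`
(`N₁₂(gg') - σ̄ g N₁₂ g' - N₁₂ g σ̄' g' = B g N₂₂ g' + N₁₁ g B g'`).  So a dual Selmer direction
`[c] ∈ H¹(Γ, Hom(σ̄, σ̄'))` deforms `ρ̄_B` to first order only if the cup products `[B] ∪ [c] ∈ H²(Γ, End σ̄)` and
`[c] ∪ [B] ∈ H²(Γ, End σ̄')` vanish. [folklore] -/
theorem stub_firstOrderCupObstruction :
    ∀ (k : Type) [Field k] (Γ : Type) [Group Γ] (σ σ' : Γ →* GL (Fin 2) k) (B : Γ → Matrix (Fin 2) (Fin 2) k)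
      (N : Γ → Matrix (Fin 2 ⊕ Fin 2) (Fin 2 ⊕ Fin 2) k),
      (∀ g g', N (g * g') = Matrix.fromBlocks (σ g).val (B g) 0 (σ' g).val * N g' +
          N g * Matrix.fromBlocks (σ g').val (B g') 0 (σ' g').val) ↔
      ((∀ g g', (N (g * g')).toBlocks₂₁ = (σ' g).val * (N g').toBlocks₂₁ + (N g).toBlocks₂₁ * (σ g').val) ∧
        (∀ g g', (N (g * g')).toBlocks₁₁ - ((σ g).val * (N g').toBlocks₁₁ + (N g).toBlocks₁₁ * (σ g').val) =
          B g * (N g').toBlocks₂₁) ∧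
        (∀ g g', (N (g * g')).toBlocks₂₂ - ((σ' g).val * (N g').toBlocks₂₂ + (N g).toBlocks₂₂ * (σ' g').val) =
          (N g).toBlocks₂₁ * B g') ∧
        (∀ g g', (N (g * g')).toBlocks₁₂ - ((σ g).val * (N g').toBlocks₁₂ + (N g).toBlocks₁₂ * (σ' g').val) =
          B g * (N g').toBlocks₂₂ + (N g).toBlocks₁₁ * B g')) := by
  intro k _ Γ _ σ σ' B N
  -- the pointwise (in `(g, g')`) blockwise reading of the derivation identity
  have key : ∀ g g' : Γ,
      N (g * g') = Matrix.fromBlocks (σ g).val (B g) 0 (σ' g).val * N g' +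
          N g * Matrix.fromBlocks (σ g').val (B g') 0 (σ' g').val ↔
        (N (g * g')).toBlocks₂₁ = (σ' g).val * (N g').toBlocks₂₁ + (N g).toBlocks₂₁ * (σ g').val ∧
          (N (g * g')).toBlocks₁₁ - ((σ g).val * (N g').toBlocks₁₁ + (N g).toBlocks₁₁ * (σ g').val) =
            B g * (N g').toBlocks₂₁ ∧
          (N (g * g')).toBlocks₂₂ - ((σ' g).val * (N g').toBlocks₂₂ + (N g).toBlocks₂₂ * (σ' g').val) =
            (N g).toBlocks₂₁ * B g' ∧
          (N (g * g')).toBlocks₁₂ - ((σ g).val * (N g').toBlocks₁₂ + (N g).toBlocks₁₂ * (σ' g').val) =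
            B g * (N g').toBlocks₂₂ + (N g).toBlocks₁₁ * B g' := fun g g' =>
    eq_fromBlocks_zero₂₁_mul_add_mul_fromBlocks_zero₂₁_iff (N (g * g')) (N g) (N g') (σ g).val (B g) (σ' g).val
      (σ g').val (B g') (σ' g').val
  -- distribute `∀ g g'` over the conjunction
  refine ⟨fun h => ⟨fun g g' => ((key g g').1 (h g g')).1, fun g g' => ((key g g').1 (h g g')).2.1,
    fun g g' => ((key g g').1 (h g g')).2.2.1, fun g g' => ((key g g').1 (h g g')).2.2.2⟩, ?_⟩
  rintro ⟨h₂₁, h₁₁, h₂₂, h₁₂⟩ g g'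
  exact (key g g').2 ⟨h₂₁ g g', h₁₁ g g', h₂₂ g g', h₁₂ g g'⟩

end Summit.Langlands.Langlands.Cruxes.ResiduallyYoshidaLifting.SectorKlingenSplit.Fibre

end
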